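import Literature.AnabelianGeometry.SemiGraphs.PSCSeparatingCoveringsThreeChainPointed
import Literature.AnabelianGeometry.SemiGraphs.PSCSeparatingCoveringsTwoComponentUnmarkedEdgesOneCusp
import Literature.AnabelianGeometry.SemiGraphs.PSCSeparatingCoveringsTwoComponentAffineEdges
import HarnessLib

/-!
# [CombGC] Prop. 1.2, proof p. 9: EDGE-LIKE separating coverings at THREE-COMPONENT CHAINS with an UNMARKED end component (row F-2827)

Mochizuki, *A combinatorial version of the Grothendieck conjecture*, Tohoku Math. J. **59** (2007)
[CombGC], PROOF of Proposition 1.2, author's manuscript p. 9, the resp'd (edge) case: "there exists a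
finite étale … `Π_G`-covering `G' → G` whose restriction to the anabelioid `G_{e₂}` is trivial …, but whose
restriction to the anabelioid `G_{e₁}` is nontrivial" [cite: MochizukiCombGC2007, Prop 1.2 proof p.9]; typed
LEVEL-WISE as `PSCDatum.EdgeLikeSeparatingCoverings` (abc-iut-w4-d081, row P12-L01-E; abc-iut FACT-LIST
row F-2827 — a schema whose universal closure is refuted as typed; the instance forms at genuine carriers are
the content).

PROOF-ONLY file (abc-iut-f-166 gen 6, row «UNMARKED-END-CHAIN»; 0 definitions).  The carrier: abc-iut-f-164's
three-component chain shape `C₀ ∪_{ν_A} C_mid ∪_{ν_B} C₁` with the LAST component UNMARKED: `s₁ = 0 < s₂ < r`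
(the marked points `c_j`, `j < s₂`, lie on `C_mid`, the `c_j`, `j ≥ s₂`, on `C₀`; `C₁` carries the handles
`i ≥ g₁` only and has positive genus; `C₀` stable), over a profinite pro-`Σ` completion `ι : Γ_{g,r} → Π`.  Then
`ε_A` is still a member of the node-loop basis of `(g₀, s₂)`, but
`η = (∏_j c_j) ∏_{i<g₁}[a_i,b_i] = (∏_{i≥g₁}[a_i,b_i])⁻¹` is a BOUNDARY WORD (the two-component node loop with
`g₁` handles on the marked side) and dies under every abelian character — the chain analogue of gen 5/6's
unmarked-`C₁` two-component datum.  The pairs of level edges are separated as follows: `ν_B/ν_B` by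
abc-iut-f-164's boundary-node theorem (`θ = exists_hom_closedComponent (g₀ := g₁)`, `c₀ ↦ η`); `ν_A/ν_A` and
`c/c` by gen 3's fibred twist; every CROSS pair through `IsProSigmaCompletion.exists_open_separating_of_hom`
with either a cusp character `δ_k − δ_m` mod `ℓ^{[Π:V]}` (it kills `η`; its value on `ε_A` is
`[s₂ ≤ k] − [s₂ ≤ m]`) or a Heisenberg handle-cusp homomorphism `(a_{i₀}, b_{i₀}, c_{j₀}) ↦ (X, Y, Z⁻¹)` mod
`ℓ^{[Π:V]}` — at a handle of `C₁` (`η ↦ Z⁻¹`, `ε_A ↦ Z^{−[s₂ ≤ j₀]}`) or, when `C₀` carries a single marked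
point, at a handle of `C₀` (`ε_A ↦ Z^{1−[s₂ ≤ j₀]}`).

* `edgeLikeSeparatingCoverings_of_threeChain_unmarkedEnd` — **F-2827** (`V' := V`) at EVERY such datum.

(F-2828 there is `unrVerticialSeparatingCoverings_of_threeChain'`, which only asks `s₁ < s₂ < r`; F-2826 needs
the cut-off twist at `C_mid`, whose group contains `η` — not in this file.)  Instance forms at data of the shape
of genuine stable curves: consistency evidence for the typed schema, not the printed theorem for all pointed
stable curves.  Nothing here takes a side on [IUTchIII] Cor. 3.12.
-/

noncomputable section

namespace Literature.AnabelianGeometry.SemiGraphs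

namespace PSCDatum

open scoped Pointwise
open Multiplicative
open Literature.AnabelianGeometry.Anabelioids (IsSigmaInteger)
open Literature.GroupTheory.CombinatorialGroupTheory
open Literature.GroupTheory.CombinatorialGroupTheory.PuncturedSurfaceGroup (a b c cuspInertia
  exists_freeGroupBasis_nodeLoop exists_freeGroupBasis_eq_c exists_handleCuspCharacter exists_hom_closedComponent
  exists_hom_handle_cusp hom_handle_cusp_nodeLoop)
open SemiGraphOfAnabelioids (IsProSigmaCompletion)
open SemiGraphOfAnabelioids.IsProSigmaCompletion (freeFactor_exists_open_separating_sameVertex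
  boundaryNode_exists_open_separating_sameEdge exists_open_separating_of_hom)
open TwoComponentAffine (character_nodeLoop sum_ite_twoDelta sum_twoDelta)

section ThreeChain

variable {P : Type} [Group P] [TopologicalSpace P] [IsTopologicalGroup P]
variable [CompactSpace P] [TotallyDisconnectedSpace P] {Sigma : Set ℕ} {g r : ℕ}

/-- **Row P12-L01-E / F-2827 (`EdgeLikeSeparatingCoverings`, `V' := V`) at EVERY three-component chain datum
whose last component is UNMARKED** (`s₁ = 0`, `1 ≤ s₂ < r`, `g₀ ≤ g₁ < g`, `C₀` stable): node/node, node/cusp,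
cusp/node and cusp/cusp pairs of level edges alike. [cite: MochizukiCombGC2007, Prop 1.2 proof p.9] -/
theorem edgeLikeSeparatingCoverings_of_threeChain_unmarkedEnd (hne : Sigma.Nonempty)
    (hprime : ∀ p ∈ Sigma, p.Prime) (ι : PuncturedSurfaceGroup g r →* P)
    (hι : IsProSigmaCompletion Sigma ι) (G : PSCDatum P) {g₀ g₁ s₁ s₂ : ℕ} (hg : g₀ ≤ g₁) (hg₁ : g₁ < g)
    (hs₁ : s₁ = 0) (hs₂ : 1 ≤ s₂) (hs₂r : s₂ < r) (hst₀ : 1 ≤ g₀ ∨ 2 ≤ r - s₂) (e : G.graph.C ≃ Fin r)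
    (hC : ∀ c', G.cuspGp c' = ((cuspInertia (g := g) (e c')).map ι).topologicalClosure)
    (εA η : PuncturedSurfaceGroup g r)
    (hεA : εA = ((List.finRange r).map fun j : Fin r =>
          if s₂ ≤ (j : ℕ) then PuncturedSurfaceGroup.c (g := g) j else 1).prod *
        ((List.finRange g).map fun i : Fin g => if (i : ℕ) < g₀ then
          PuncturedSurfaceGroup.a (r := r) i * PuncturedSurfaceGroup.b i *
            (PuncturedSurfaceGroup.a i)⁻¹ * (PuncturedSurfaceGroup.b i)⁻¹ else 1).prod)
    (hη : η = ((List.finRange r).map fun j : Fin r =>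
          if s₁ ≤ (j : ℕ) then PuncturedSurfaceGroup.c (g := g) j else 1).prod *
        ((List.finRange g).map fun i : Fin g => if (i : ℕ) < g₁ then
          PuncturedSurfaceGroup.a (r := r) i * PuncturedSurfaceGroup.b i *
            (PuncturedSurfaceGroup.a i)⁻¹ * (PuncturedSurfaceGroup.b i)⁻¹ else 1).prod)
    (nA nB : G.graph.N) (hN : ∀ n, n = nA ∨ n = nB)
    (hEA : G.nodeGp nA = ((Subgroup.zpowers εA).map ι).topologicalClosure)
    (hEB : G.nodeGp nB = ((Subgroup.zpowers η).map ι).topologicalClosure) :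
    G.EdgeLikeSeparatingCoverings := by
  classical
  subst hs₁
  obtain ⟨r', rfl⟩ : ∃ r', r = r' + 1 := ⟨r - 1, by omega⟩
  obtain ⟨g₂, rfl⟩ : ∃ g₂, g = g₁ + g₂ := ⟨g - g₁, by omega⟩
  have hg₂ : 1 ≤ g₂ := by omega
  obtain ⟨ℓ, hℓS⟩ := hne
  have hℓ : ℓ.Prime := hprime ℓ hℓS
  -- the node-loop basis of `(g₀, s₂)` (carries `ε_A`) and the closed component `B = ⟨a_i, b_i : i ≥ g₁⟩`
  obtain ⟨bA, ha, hb, -, hkA⟩ := exists_freeGroupBasis_nodeLoop (g₁ + g₂) r' g₀ s₂ hs₂ (by omega) εA hεA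
  obtain ⟨θ, hθinj, -, -, hθc, hθrange⟩ := exists_hom_closedComponent (g₀ := g₁) (g₁ := g₂) (r' := r') η hη
  obtain ⟨S_B, hS_B⟩ : ∃ S : Set ((Fin (g₁ + g₂) × Bool) ⊕ Fin r'),
      S = {x | Sum.elim (fun p : Fin (g₁ + g₂) × Bool => g₁ ≤ (p.1 : ℕ)) (fun _ : Fin r' => False) x} :=
    ⟨_, rfl⟩
  have hθB : θ.range = Subgroup.closure (bA '' S_B) := by
    rw [hθrange, hS_B]
    congr 1
    ext x
    constructor
    · rintro ⟨i, hi, rfl | rfl⟩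
      · exact ⟨Sum.inl (i, false), hi, ha i⟩
      · exact ⟨Sum.inl (i, true), hi, hb i⟩
    · rintro ⟨y, hy, rfl⟩
      rcases y with ⟨i, _ | _⟩ | j
      · exact ⟨i, hy, Or.inl (ha i)⟩
      · exact ⟨i, hy, Or.inr (hb i)⟩
      · exact absurd hy id
  -- the node generators (`nA ≠ nB` is not needed: the other node is `nB` by `hN`)
  obtain ⟨xs, hxs⟩ : ∃ f : G.graph.N → PuncturedSurfaceGroup (g₁ + g₂) (r' + 1),
      f = fun n => if n = nA then εA else η := ⟨_, rfl⟩
  have hxA : ∀ n, n = nA → xs n = εA := fun n hn => by rw [hxs]; exact if_pos hn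
  have hxB : ∀ n, n ≠ nA → xs n = η := fun n hn => by rw [hxs]; exact if_neg hn
  have hEn : ∀ n, G.edgeGp (Sum.inl n) = ((Subgroup.zpowers (xs n)).map ι).topologicalClosure := by
    intro n
    change G.nodeGp n = _
    by_cases hn : n = nA
    · rw [hxA n hn, hn, hEA]
    · rcases hN n with h | h
      · exact absurd h hn
      · rw [hxB n hn, h, hEB]
  have hEc : ∀ c', G.edgeGp (Sum.inr c') = ((Subgroup.zpowers (c (e c'))).map ι).topologicalClosure :=
    fun c' => hC c'
  have hslot : s₂ - 1 < r' := by omega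
  have hEnA : ∀ n, n = nA → G.edgeGp (Sum.inl n) =
      ((Subgroup.closure (bA '' {Sum.inr ⟨s₂ - 1, hslot⟩})).map ι).topologicalClosure := fun n hn => by
    rw [hEn n, hxA n hn, Set.image_singleton, hkA, Subgroup.zpowers_eq_closure]
  have hEnB : ∀ n, n ≠ nA → G.edgeGp (Sum.inl n) =
      ((Subgroup.zpowers (θ (c 0))).map ι).topologicalClosure := fun n hn => by
    rw [hEn n, hxB n hn, hθc]
  have hιn : ∀ n, ι (xs n) ∈ G.edgeGp (Sum.inl n) := fun n => by
    rw [hEn]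
    exact Subgroup.le_topologicalClosure _ (Subgroup.mem_map_of_mem ι (Subgroup.mem_zpowers _))
  have hιc : ∀ c', ι (c (e c')) ∈ G.edgeGp (Sum.inr c') := fun c' => by
    rw [hEc]
    exact Subgroup.le_topologicalClosure _ (Subgroup.mem_map_of_mem ι (Subgroup.mem_zpowers _))
  -- two marked points at least: one on `C_mid` (`c_0`), one on `C₀` (`c_{s₂}`)
  have hother : ∀ k : Fin (r' + 1), ∃ j : Fin (r' + 1), j ≠ k := fun k => by
    by_cases hk : (k : ℕ) = 0
    · exact ⟨⟨s₂, by omega⟩, fun h => by rw [← h] at hk; simp only at hk; omega⟩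
    · exact ⟨⟨0, by omega⟩, fun h => by rw [← h] at hk; exact hk rfl⟩
  have hK₀ : ∀ k : Fin (r' + 1), (∃ j : Fin (r' + 1), s₂ ≤ (j : ℕ) ∧ j ≠ k) ∨ (s₂ ≤ (k : ℕ) ∧ 1 ≤ g₀) := by
    intro k
    by_cases hk : k = ⟨s₂, by omega⟩
    · rcases hst₀ with h | h
      · exact Or.inr ⟨by rw [hk], h⟩
      · exact Or.inl ⟨⟨s₂ + 1, by omega⟩, by simp only; omega, fun h' => by
          rw [hk] at h'; exact absurd (congrArg Fin.val h') (by simp)⟩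
    · exact Or.inl ⟨⟨s₂, by omega⟩, le_rfl, fun h' => hk h'.symm⟩
  intro V hVn hVo
  haveI := hVn
  refine ⟨V, hVn, hVo, le_rfl, ?_⟩
  -- the finite `Σ`-targets mod `ℓ^m`, `m = [Π : V]`
  have hVi : IsSigmaInteger Sigma V.index := hι.index_open V hVn hVo
  set m : ℕ := V.index with hm
  have hmpos : 0 < m := hVi.1
  have hmlt : m < ℓ ^ m := Nat.lt_pow_self hℓ.one_lt
  haveI : NeZero (ℓ ^ m) := ⟨pow_ne_zero _ hℓ.ne_zero⟩
  have hZM : IsSigmaInteger Sigma (Nat.card (Multiplicative (ZMod (ℓ ^ m)))) := by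
    rw [show Nat.card (Multiplicative (ZMod (ℓ ^ m))) = ℓ ^ m from Nat.card_zmod (ℓ ^ m)]
    exact Literature.AnabelianGeometry.SemiGraphs.isSigmaInteger_prime_pow hℓ hℓS _
  have hpow1 : (ofAdd (1 : ZMod (ℓ ^ m))) ^ m ≠ 1 := by
    rw [← ofAdd_nsmul, nsmul_eq_mul, mul_one, Ne, ofAdd_eq_one, ZMod.natCast_eq_zero_iff]
    exact fun h => absurd (Nat.le_of_dvd hmpos h) (not_le.mpr hmlt)
  obtain ⟨φH, X, Y, Z, hXYZ, -, hZpow, hcard⟩ := Heisenberg.exists_heisenbergTriple_central (ℓ ^ m)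
  haveI : Finite (Multiplicative (ZMod (ℓ ^ m) × ZMod (ℓ ^ m)) ⋊[φH] Multiplicative (ZMod (ℓ ^ m))) :=
    Nat.finite_of_card_ne_zero (by rw [hcard]; exact pow_ne_zero _ (pow_ne_zero _ hℓ.ne_zero))
  have hHM : IsSigmaInteger Sigma
      (Nat.card (Multiplicative (ZMod (ℓ ^ m) × ZMod (ℓ ^ m)) ⋊[φH] Multiplicative (ZMod (ℓ ^ m)))) := by
    rw [hcard, ← pow_mul]
    exact Literature.AnabelianGeometry.SemiGraphs.isSigmaInteger_prime_pow hℓ hℓS _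
  have hZm : Z ^ m ≠ 1 := fun h => absurd (Nat.le_of_dvd hmpos ((hZpow m).mp h)) (not_le.mpr hmlt)
  have hZm' : Z⁻¹ ^ m ≠ 1 := by rw [inv_pow]; exact inv_ne_one.mpr hZm
  have hW : X * Y * X⁻¹ * Y⁻¹ * Z⁻¹ = 1 := by rw [hXYZ, mul_inv_cancel]
  -- abelian certificates `δ_k − δ_m` mod `ℓ^m`: they kill `η`; value on `ε_A` is `[s₂ ≤ k] − [s₂ ≤ m]`
  have habel : ∀ k m' : Fin (r' + 1), k ≠ m' →
      ∃ χ : PuncturedSurfaceGroup (g₁ + g₂) (r' + 1) →* Multiplicative (ZMod (ℓ ^ m)),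
        χ (c k) = ofAdd 1 ∧ (∀ j, j ≠ k → j ≠ m' → χ (c j) = 1) ∧
          χ εA = ofAdd ((if s₂ ≤ (k : ℕ) then (1 : ZMod (ℓ ^ m)) else 0) +
            (if s₂ ≤ (m' : ℕ) then (-1 : ZMod (ℓ ^ m)) else 0)) ∧ χ η = 1 := by
    intro k m' hkm
    obtain ⟨χ, -, -, hχc⟩ := exists_handleCuspCharacter (g := g₁ + g₂) (r := r' + 1) (n := ℓ ^ m)
      (fun _ => 0) (fun _ => 0)
      (fun j => (if j = k then (1 : ZMod (ℓ ^ m)) else 0) + (if j = m' then (-1 : ZMod (ℓ ^ m)) else 0))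
      (sum_twoDelta k m')
    refine ⟨χ, ?_, fun j hjk hjm => ?_, ?_, ?_⟩
    · rw [hχc, if_pos rfl, if_neg hkm, add_zero]
    · rw [hχc, if_neg hjk, if_neg hjm, add_zero, ofAdd_zero]
    · rw [hεA, character_nodeLoop χ hχc g₀ s₂, sum_ite_twoDelta]
    · rw [hη, character_nodeLoop χ hχc g₁ 0, sum_ite_twoDelta, if_pos (Nat.zero_le _),
        if_pos (Nat.zero_le _), add_neg_cancel, ofAdd_zero]
  -- Heisenberg certificates: handle `i₀`, cusp `j₀ ↦ Z⁻¹`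
  have hheis : ∀ (i₀ : Fin (g₁ + g₂)) (j₀ : Fin (r' + 1)),
      ∃ ψ : PuncturedSurfaceGroup (g₁ + g₂) (r' + 1) →*
        Multiplicative (ZMod (ℓ ^ m) × ZMod (ℓ ^ m)) ⋊[φH] Multiplicative (ZMod (ℓ ^ m)),
        ψ (c j₀) = Z⁻¹ ∧ (∀ j, j ≠ j₀ → ψ (c j) = 1) ∧
          ψ εA = (if s₂ ≤ (j₀ : ℕ) then Z⁻¹ else 1) * (if (i₀ : ℕ) < g₀ then Z else 1) ∧
          ψ η = Z⁻¹ * (if (i₀ : ℕ) < g₁ then Z else 1) := by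
    intro i₀ j₀
    obtain ⟨ψ, ha', hb', hc', hab, hcj⟩ := exists_hom_handle_cusp (g := g₁ + g₂) (r := r' + 1) i₀ j₀ X Y Z⁻¹ hW
    refine ⟨ψ, hc', hcj, ?_, ?_⟩
    · rw [hεA, hom_handle_cusp_nodeLoop ψ ha' hb' hc' hab hcj g₀ s₂, hXYZ]
    · rw [hη, hom_handle_cusp_nodeLoop ψ ha' hb' hc' hab hcj g₁ 0, if_pos (Nat.zero_le _), hXYZ]
  -- membership of powers in cyclic subgroups under a hom that kills the generator
  have hkill : ∀ {M : Type} [Group M] (φ : PuncturedSurfaceGroup (g₁ + g₂) (r' + 1) →* M)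
      (z : PuncturedSurfaceGroup (g₁ + g₂) (r' + 1)), φ z = 1 → ∀ x ∈ Subgroup.zpowers z, φ x = 1 := by
    intro M _ φ z hz x hx
    obtain ⟨t, rfl⟩ := Subgroup.mem_zpowers_iff.mp hx
    rw [map_zpow, hz, one_zpow]
  have hi₁ : ¬ ((⟨g₁, by omega⟩ : Fin (g₁ + g₂)) : ℕ) < g₁ := lt_irrefl _
  have hi₁' : ¬ ((⟨g₁, by omega⟩ : Fin (g₁ + g₂)) : ℕ) < g₀ := by simp only; omega
  rintro (n₁ | c₁) (n₂ | c₂) γ₁ γ₂ hne12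
  · -- node / node
    by_cases h12 : n₁ = n₂
    · subst h12
      have hne' := hne12.resolve_left fun h => h rfl
      by_cases h1 : n₁ = nA
      · -- `ν_A / ν_A`: fibred twist along the basis member `ε_A`
        have hA := hEnA n₁ h1
        clear_value m
        exact freeFactor_exists_open_separating_sameVertex hι bA _ (Set.singleton_nonempty _) hℓ hℓS _ hA V
          hVo γ₁ γ₂ hne'
      · -- `ν_B / ν_B`: the boundary-node theorem for `B = ⟨a_i, b_i : i ≥ g₁⟩`
        exact boundaryNode_exists_open_separating_sameEdge hι bA S_B _ rfl hg₂ θ hθinj hθB hℓ hℓS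
          (G.edgeGp (Sum.inl n₁)) (hEnB n₁ h1) V hVo γ₁ γ₂ hne'
    · by_cases h1 : n₁ = nA
      · -- alive `ε_A`, killed `η`: the character `δ_{s₂} − δ_0`
        have h2 : n₂ ≠ nA := fun h => h12 (h1.trans h.symm)
        obtain ⟨χ, -, -, hχA, hχB⟩ := habel ⟨s₂, by omega⟩ ⟨0, by omega⟩
          (fun h => by have := congrArg Fin.val h; simp only at this; omega)
        refine exists_open_separating_of_hom hι hZM χ (G.edgeGp (Sum.inl n₂)) (Subgroup.zpowers (xs n₂))
          (hEn n₂) (hkill χ _ (by rw [hxB n₂ h2, hχB])) (G.edgeGp (Sum.inl n₁)) (xs n₁) (hιn n₁) V hVo ?_ γ₁ γ₂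
        rw [hxA n₁ h1, hχA, if_pos (show s₂ ≤ ((⟨s₂, _⟩ : Fin (r' + 1)) : ℕ) from le_rfl),
          if_neg (show ¬ s₂ ≤ ((⟨0, _⟩ : Fin (r' + 1)) : ℕ) by simp only; omega), add_zero]
        exact hpow1
      · -- alive `η`, killed `ε_A`: Heisenberg at a handle of `C₁`, cusp `c_0`
        have h2 : n₂ = nA := by
          rcases hN n₂ with h | h
          · exact h
          · rcases hN n₁ with h' | h'
            · exact absurd h' h1
            · exact absurd (h'.trans h.symm) h12
        obtain ⟨ψ, -, -, hψA, hψB⟩ := hheis ⟨g₁, by omega⟩ ⟨0, by omega⟩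
        refine exists_open_separating_of_hom hι hHM ψ (G.edgeGp (Sum.inl n₂)) (Subgroup.zpowers (xs n₂))
          (hEn n₂) (hkill ψ _ ?_) (G.edgeGp (Sum.inl n₁)) (xs n₁) (hιn n₁) V hVo ?_ γ₁ γ₂
        · rw [hxA n₂ h2, hψA, if_neg (show ¬ s₂ ≤ ((⟨0, _⟩ : Fin (r' + 1)) : ℕ) by simp only; omega),
            if_neg hi₁', one_mul]
        · rw [hxB n₁ h1, hψB, if_neg hi₁, mul_one]
          exact hZm'
  · -- alive: a node; killed: the cusp `k = e c₂`
    by_cases h1 : n₁ = nA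
    · by_cases hk : (e c₂ : ℕ) < s₂
      · -- `ε_A` alive, a `C_mid` cusp killed: Heisenberg at a `C₁` handle with the cusp `c_{s₂}`
        obtain ⟨ψ, -, hψj, hψA, -⟩ := hheis ⟨g₁, by omega⟩ ⟨s₂, by omega⟩
        refine exists_open_separating_of_hom hι hHM ψ (G.edgeGp (Sum.inr c₂)) (Subgroup.zpowers (c (e c₂)))
          (hEc c₂) (hkill ψ _ (hψj _ fun h => by rw [h] at hk; simp only at hk; omega))
          (G.edgeGp (Sum.inl n₁)) (xs n₁) (hιn n₁) V hVo ?_ γ₁ γ₂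
        rw [hxA n₁ h1, hψA, if_pos (show s₂ ≤ ((⟨s₂, _⟩ : Fin (r' + 1)) : ℕ) from le_rfl), if_neg hi₁',
          mul_one]
        exact hZm'
      · rcases hK₀ (e c₂) with ⟨j₁, hj₁, hj₁k⟩ | ⟨-, hg₀⟩
        · -- a spare `C₀` cusp `j₁`: the character `δ_{j₁} − δ_0`
          have hj10 : j₁ ≠ ⟨0, by omega⟩ := fun h => by rw [h] at hj₁; simp only at hj₁; omega
          have hk0 : (⟨0, by omega⟩ : Fin (r' + 1)) ≠ e c₂ := fun h => by rw [← h] at hk; simp only at hk; omega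
          obtain ⟨χ, -, hχ0, hχA, -⟩ := habel j₁ ⟨0, by omega⟩ hj10
          refine exists_open_separating_of_hom hι hZM χ (G.edgeGp (Sum.inr c₂)) (Subgroup.zpowers (c (e c₂)))
            (hEc c₂) (hkill χ _ (hχ0 _ hj₁k.symm hk0.symm)) (G.edgeGp (Sum.inl n₁)) (xs n₁) (hιn n₁) V hVo ?_
            γ₁ γ₂
          rw [hxA n₁ h1, hχA, if_pos hj₁, if_neg (show ¬ s₂ ≤ ((⟨0, _⟩ : Fin (r' + 1)) : ℕ) by simp only; omega),
            add_zero]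
          exact hpow1
        · -- `k` is the only `C₀` cusp: Heisenberg at a `C₀` handle with the cusp `c_0`
          obtain ⟨ψ, -, hψj, hψA, -⟩ := hheis ⟨0, by omega⟩ ⟨0, by omega⟩
          refine exists_open_separating_of_hom hι hHM ψ (G.edgeGp (Sum.inr c₂)) (Subgroup.zpowers (c (e c₂)))
            (hEc c₂) (hkill ψ _ (hψj _ fun h => by rw [h] at hk; simp only at hk; omega))
            (G.edgeGp (Sum.inl n₁)) (xs n₁) (hιn n₁) V hVo ?_ γ₁ γ₂
          rw [hxA n₁ h1, hψA, if_neg (show ¬ s₂ ≤ ((⟨0, _⟩ : Fin (r' + 1)) : ℕ) by simp only; omega),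
            if_pos (show ((⟨0, _⟩ : Fin (g₁ + g₂)) : ℕ) < g₀ by simp only; omega), one_mul]
          exact hZm
    · -- `η` alive, a cusp killed: Heisenberg at a `C₁` handle with another cusp
      obtain ⟨j₀, hj₀⟩ := hother (e c₂)
      obtain ⟨ψ, -, hψj, -, hψB⟩ := hheis ⟨g₁, by omega⟩ j₀
      refine exists_open_separating_of_hom hι hHM ψ (G.edgeGp (Sum.inr c₂)) (Subgroup.zpowers (c (e c₂)))
        (hEc c₂) (hkill ψ _ (hψj _ hj₀.symm)) (G.edgeGp (Sum.inl n₁)) (xs n₁) (hιn n₁) V hVo ?_ γ₁ γ₂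
      rw [hxB n₁ h1, hψB, if_neg hi₁, mul_one]
      exact hZm'
  · -- alive: the cusp `k = e c₁`; killed: a node
    by_cases h2 : n₂ = nA
    · by_cases hk : (e c₁ : ℕ) < s₂
      · -- killed `ε_A`, alive `C_mid` cusp: Heisenberg at a `C₁` handle with the cusp `k` itself
        obtain ⟨ψ, hψk, -, hψA, -⟩ := hheis ⟨g₁, by omega⟩ (e c₁)
        refine exists_open_separating_of_hom hι hHM ψ (G.edgeGp (Sum.inl n₂)) (Subgroup.zpowers (xs n₂))
          (hEn n₂) (hkill ψ _ ?_) (G.edgeGp (Sum.inr c₁)) (c (e c₁)) (hιc c₁) V hVo (by rw [hψk]; exact hZm')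
          γ₁ γ₂
        rw [hxA n₂ h2, hψA, if_neg (by omega), if_neg hi₁', one_mul]
      · rcases hK₀ (e c₁) with ⟨m', hm', hmk⟩ | ⟨-, hg₀⟩
        · -- a spare `C₀` cusp `m'`: the character `δ_k − δ_{m'}` kills `ε_A`
          obtain ⟨χ, hχk, -, hχA, -⟩ := habel (e c₁) m' hmk.symm
          refine exists_open_separating_of_hom hι hZM χ (G.edgeGp (Sum.inl n₂)) (Subgroup.zpowers (xs n₂))
            (hEn n₂) (hkill χ _ ?_) (G.edgeGp (Sum.inr c₁)) (c (e c₁)) (hιc c₁) V hVo (by rw [hχk]; exact hpow1)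
            γ₁ γ₂
          rw [hxA n₂ h2, hχA, if_pos (by omega), if_pos hm', add_neg_cancel, ofAdd_zero]
        · -- `k` is the only `C₀` cusp: Heisenberg at a `C₀` handle with the cusp `k`
          obtain ⟨ψ, hψk, -, hψA, -⟩ := hheis ⟨0, by omega⟩ (e c₁)
          refine exists_open_separating_of_hom hι hHM ψ (G.edgeGp (Sum.inl n₂)) (Subgroup.zpowers (xs n₂))
            (hEn n₂) (hkill ψ _ ?_) (G.edgeGp (Sum.inr c₁)) (c (e c₁)) (hιc c₁) V hVo (by rw [hψk]; exact hZm')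
            γ₁ γ₂
          rw [hxA n₂ h2, hψA, if_pos (by omega),
            if_pos (show ((⟨0, _⟩ : Fin (g₁ + g₂)) : ℕ) < g₀ by simp only; omega), inv_mul_cancel]
    · -- killed `η`: any cusp character kills it
      obtain ⟨m', hmk⟩ := hother (e c₁)
      obtain ⟨χ, hχk, -, -, hχB⟩ := habel (e c₁) m' hmk.symm
      exact exists_open_separating_of_hom hι hZM χ (G.edgeGp (Sum.inl n₂)) (Subgroup.zpowers (xs n₂))
        (hEn n₂) (hkill χ _ (by rw [hxB n₂ h2, hχB])) (G.edgeGp (Sum.inr c₁)) (c (e c₁)) (hιc c₁) V hVo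
        (by rw [hχk]; exact hpow1) γ₁ γ₂
  · -- cusp / cusp
    by_cases h12 : c₁ = c₂
    · subst h12
      have hne' := hne12.resolve_left fun h => h rfl
      obtain ⟨β, bs, k, hk⟩ := exists_freeGroupBasis_eq_c (g := g₁ + g₂) (by omega : 2 ≤ r' + 1) (e c₁)
      have hform : G.edgeGp (Sum.inr c₁) = ((Subgroup.closure (bs '' {k})).map ι).topologicalClosure := by
        rw [hEc, Set.image_singleton, hk, Subgroup.zpowers_eq_closure]
      exact freeFactor_exists_open_separating_sameVertex hι bs {k} (Set.singleton_nonempty _) hℓ hℓS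
        (G.edgeGp (Sum.inr c₁)) hform V hVo γ₁ γ₂ hne'
    · have hkm : e c₁ ≠ e c₂ := fun h => h12 (e.injective h)
      obtain ⟨ψ, hψk, hψj, -, -⟩ := hheis ⟨g₁, by omega⟩ (e c₁)
      exact exists_open_separating_of_hom hι hHM ψ (G.edgeGp (Sum.inr c₂)) (Subgroup.zpowers (c (e c₂)))
        (hEc c₂) (hkill ψ _ (hψj _ hkm.symm)) (G.edgeGp (Sum.inr c₁)) (c (e c₁)) (hιc c₁) V hVo
        (by rw [hψk]; exact hZm') γ₁ γ₂

end ThreeChain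

end PSCDatum

end Literature.AnabelianGeometry.SemiGraphs

end
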